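import Summits.QuantumFields.YangMills.Theorems.BalabanUVNodesN15KingModelOneDimensionalClosedForm
import Literature.MathematicalPhysics.QuantumLattice.LiebRobinsonGaussianFilterProofs
import Literature.Analysis.Fourier.TentFunction

/-!
# BalabanUVNodes ∕ N15 — THE KING-MODEL RUNG (PART Ϻ-a): THE ONE-LINE HEAT-KERNEL ENGINE —
# the Fejér∕tent Fourier pair `∫ sinc²(q∕2)cos(qt)dq = 2π(1−|t|)₊` IN FULL, the line heat kernel `g_t(a) = (4πt)^{−1∕2}e^{−a²∕4t}` as the cosine
# transform of `e^{−tq²}`, and `I_t(x) := ∫ sinc²(q∕2)e^{−tq²}cos(qx)dq = 2π·(Λ ∗ g_t)(x) > 0` with its Gaussian envelopes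
# (Track A, DAG node N15 = NE2; FAN-OUT v1.1 §N15 s3 «KING-MODEL RUNG»; count-neutral)

HONEST FRAMING.  Count-neutral (cell `pub-ymgap`, seat `pub-ymgap-dag-n15-e` g35; `--supports stmt-QuantumFields-27366 --as helper` = K3⁸).  TEMPLATE LITERATURE:
C. King, *The U(1) Higgs model. I. The continuum limit*, Commun. Math. Phys. **102** (1986) 649–677 [King1986] — King's OWN `A = 0`, `g = 0` MODEL.  Part Ϝ-j's
thermodynamic limit of the block-smeared two-point function is the momentum integral `S₂^{ℝ}(z) = (2π)^{−(d+1)}∫Π_μ sinc²(p_μ∕2)·cos(p·z)∕(|p|²+m²)dp` ((4.5) p.670 at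
`η = 0`, (2.22) p.654).  PART Ϻ (san) rewrites it in SCHWINGER's PROPER-TIME form, `1∕(|p|²+m²) = ∫₀^∞e^{−t(|p|²+m²)}dt`, after which the momentum integral FACTORISES over
the coordinates into the one-line integrals `I_t(z_μ)`, `I_t(x) := ∫_ℝ sinc²(q∕2)e^{−tq²}cos(qx)dq`.  THIS FILE is the one-line engine: (i) the Fejér∕tent pair IN FULL,
`∫_ℝ sinc²(q∕2)cos(qt)dq = π(|t+1| + |t−1| − 2|t|) = 2π(1−|t|)₊` (part Ϸ-i proved the vanishing for `|t| ≥ 1` only; the value `∫(1−cos x)∕x² = π` comes from part Ϸ-p's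
`∫sinc²(x∕2) = 2π`); (ii) the line heat kernel `g_t(a) = (4πt)^{−1∕2}e^{−a²∕(4t)}` (`gaussLine`) with `∫g_t = 1` and `∫g_t(s)cos(qs)ds = e^{−tq²}` (the tree's
`Literature.MathematicalPhysics.QuantumLattice.integral_cos_mul_gaussian` BY NAME); (iii) by ONE Fubini swap and two Haar substitutions,
`I_t(x) = 2π∫_ℝ Λ(u)·g_t(x−u)du` with `Λ = tent 1` the tree's tent `(1−|u|)₊` (`Literature.Analysis.Fourier.tent`): the block form factor smears the heat kernel by the
tent `Λ = χ_{[0,1]} ∗ χ_{[−1,0]}`; hence `I_t(x) > 0` for EVERY `x` and `t > 0`, with the envelopes `2π·g_t(|x|+1) ≤ I_t(x) ≤ 2π·g_t((|x|−1)₊)` and the cap `I_t(x) ≤ 2π`.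
NOT Bałaban's objects; NOT a node discharge (N15 is booked through n15-a's knit, untouched here); nothing continuum-Yang–Mills ∕ `ℝ⁴` ∕ OS ∕ Clay.  0 `sorry`; standard axioms;
TWO definitions (`gaussLine`, `lineHeat` — the objects of the proper-time form, consumed by parts Ϻ-b∕c∕d).

WHAT THIS FILE PROVES (kernel).  §1 `integral_one_sub_cos_div_sq` (`= π`), ★★ **`integral_sinc_sq_half_mul_cos`** (all `t`), `abs_add_one_add_abs_sub_one_sub_two_abs` (`= 2(1−|t|)₊ = 2·tent 1 t`),
★★ **`integral_sinc_sq_half_mul_cos_eq_tent`**.  §2 `gaussLine` (+ `_pos`, `_nonneg`, `_neg`, `_zero`, `_le_zero_val`, ★ `gaussLine_anti` (decreasing in `|a|`), `continuous_gaussLine`,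
`integrable_gaussLine`, ★ `integral_gaussLine` (`= 1`), ★ `integral_gaussLine_mul_cos` (`= e^{−tq²}`)).  §3 `lineHeat`, `integral_tent_one` (`∫_ℝ Λ = 1`), `integrable_tent_mul_gaussLine`,
★★★ **`lineHeat_eq_integral_tent`** (`I_t(x) = 2π∫Λ(u)g_t(x−u)du`), ★★ **`lineHeat_pos`**, ★ `lineHeat_le_two_pi`, ★ `lineHeat_le_envelope` (`≤ 2π g_t(|x|−1)`, `|x| ≥ 1`),
`lineHeat_le_peak` (`≤ 2π g_t(0) = √(π∕t)`), ★ `envelope_le_lineHeat` (`2π g_t(|x|+1) ≤ I_t(x)`).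

HONEST SCOPE.  One-dimensional real analysis (folklore: Fejér kernel, heat kernel, Schwinger parametrisation); its reading on King's free model is parts Ϻ-b–d.
N15 untouched; counts unmoved.  Locators (use): [King1986] (4.5) p.670, (4.36) p.674, Thm 2.1 (2.22) p.654, Thm 3.3 (3.6) p.655; [ButzerNessel1971] (12.4.3).
-/

noncomputable section

open scoped BigOperators Topology
open Filter MeasureTheory Set Function

namespace Summit.QuantumFields.YangMills.BalabanUVNodes.N15KingModelRung.ProperTime

open Summit.QuantumFields.YangMills.BalabanUVNodes.N15KingModelRung.OptimalDecay
open Literature.Analysis.Fourier (tent tent_nonneg tent_le_one tent_neg tent_eq tent_eq_zero continuous_tent integral_tent abs_lt_of_tent_ne_zero)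

/-! ## §1 The Fejér ∕ tent Fourier pair in full -/

/-- `∫_ℝ (1 − cos x)∕x² dx = π` (half of part Ϸ-p's `∫sinc²(x∕2) = 2π`, since `sinc²(x∕2) = 2(1 − cos x)∕x²` a.e.). [cite: ButzerNessel1971, (12.4.3)] -/
theorem integral_one_sub_cos_div_sq : ∫ x : ℝ, (1 - Real.cos x) / x ^ 2 = Real.pi := by
  have h0 : ∀ᵐ x : ℝ ∂volume, x ≠ 0 := by simp [ae_iff]
  have hae : (fun x : ℝ => Real.sinc (x / 2) ^ 2) =ᵐ[volume] fun x => 2 * ((1 - Real.cos x) / x ^ 2) := by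
    filter_upwards [h0] with x hx
    rw [sinc_sq_half_eq hx]
    ring
  have h := integral_sinc_sq_half
  rw [integral_congr_ae hae, integral_const_mul] at h
  linarith

/-- ★★ **The Fejér ∕ tent pair, all `t`**: `∫_ℝ sinc²(x∕2)cos(xt)dx = π(|t+1| + |t−1| − 2|t|)` (part Ϸ-i's three-term identity and scaling; the value `π` from above).
[cite: ButzerNessel1971, (12.4.3)] -/
theorem integral_sinc_sq_half_mul_cos (t : ℝ) :
    ∫ x : ℝ, Real.sinc (x / 2) ^ 2 * Real.cos (x * t) = Real.pi * (|t + 1| + |t - 1| - 2 * |t|) := by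
  have h0 : ∀ᵐ x : ℝ ∂volume, x ≠ 0 := by simp [ae_iff]
  have hae : (fun x : ℝ => Real.sinc (x / 2) ^ 2 * Real.cos (x * t))
      =ᵐ[volume] fun x => ((1 - Real.cos ((t + 1) * x)) / x ^ 2 + (1 - Real.cos ((t - 1) * x)) / x ^ 2) - 2 * ((1 - Real.cos (t * x)) / x ^ 2) := by
    filter_upwards [h0] with x hx using sinc_sq_half_mul_cos_eq hx t
  have hA := integrable_one_sub_cos_div_sq (t + 1)
  have hB := integrable_one_sub_cos_div_sq (t - 1)
  have hC := integrable_one_sub_cos_div_sq t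
  have hAB : Integrable fun x : ℝ => (1 - Real.cos ((t + 1) * x)) / x ^ 2 + (1 - Real.cos ((t - 1) * x)) / x ^ 2 := hA.add hB
  have hC2 : Integrable fun x : ℝ => 2 * ((1 - Real.cos (t * x)) / x ^ 2) := hC.const_mul 2
  rw [integral_congr_ae hae, integral_sub hAB hC2, integral_add hA hB, integral_const_mul,
    integral_one_sub_cos_div_sq_eq (t + 1), integral_one_sub_cos_div_sq_eq (t - 1), integral_one_sub_cos_div_sq_eq t, integral_one_sub_cos_div_sq]
  ring

/-- `|t+1| + |t−1| − 2|t| = 2(1−|t|)₊ = 2·tent 1 t` (the tree's tent of half-width `1`). [folklore] -/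
theorem abs_add_one_add_abs_sub_one_sub_two_abs (t : ℝ) : |t + 1| + |t - 1| - 2 * |t| = 2 * tent 1 t := by
  rcases le_or_gt (|t|) 1 with h | h
  · rw [tent_eq one_pos h, div_one]
    rw [abs_le] at h
    rw [abs_of_nonneg (by linarith : (0 : ℝ) ≤ t + 1), abs_of_nonpos (by linarith : t - 1 ≤ 0)]
    rcases le_or_gt 0 t with ht | ht
    · rw [abs_of_nonneg ht]; ring
    · rw [abs_of_neg ht]; ring
  · rw [tent_eq_zero one_pos h.le, mul_zero]
    rcases le_or_gt 0 t with ht | ht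
    · rw [abs_of_nonneg ht] at h
      rw [abs_of_nonneg ht, abs_of_nonneg (by linarith : (0 : ℝ) ≤ t + 1), abs_of_nonneg (by linarith : (0 : ℝ) ≤ t - 1)]
      ring
    · rw [abs_of_neg ht] at h
      rw [abs_of_neg ht, abs_of_nonpos (by linarith : t + 1 ≤ 0), abs_of_neg (by linarith : t - 1 < 0)]
      ring

/-- ★★ **`∫_ℝ sinc²(x∕2)cos(xt)dx = 2π·(1−|t|)₊`**: the Fourier transform of King's one-line block form factor `sinc²(x∕2)` IS `2π` times the tent `Λ = χ_{[0,1]} ∗ χ_{[−1,0]}`.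
[cite: ButzerNessel1971, (12.4.3)] -/
theorem integral_sinc_sq_half_mul_cos_eq_tent (t : ℝ) : ∫ x : ℝ, Real.sinc (x / 2) ^ 2 * Real.cos (x * t) = 2 * Real.pi * tent 1 t := by
  rw [integral_sinc_sq_half_mul_cos, abs_add_one_add_abs_sub_one_sub_two_abs]
  ring

/-! ## §2 The line heat kernel `g_t(a) = (4πt)^{−1∕2}e^{−a²∕(4t)}` -/

/-- The ONE-DIMENSIONAL HEAT KERNEL at time `t`: `g_t(a) = (4πt)^{−1∕2}·e^{−a²∕(4t)}` (the Gaussian of variance `2t`). [folklore] -/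
def gaussLine (t a : ℝ) : ℝ := (Real.sqrt (4 * Real.pi * t))⁻¹ * Real.exp (-(a ^ 2 / (4 * t)))

/-- `g_t(a) > 0` (`t > 0`). [folklore] -/
theorem gaussLine_pos {t : ℝ} (ht : 0 < t) (a : ℝ) : 0 < gaussLine t a := by
  unfold gaussLine
  have : 0 < Real.sqrt (4 * Real.pi * t) := Real.sqrt_pos.mpr (by positivity)
  positivity

/-- `g_t(a) ≥ 0`. [folklore] -/
theorem gaussLine_nonneg (t a : ℝ) : 0 ≤ gaussLine t a := by
  unfold gaussLine
  exact mul_nonneg (inv_nonneg.mpr (Real.sqrt_nonneg _)) (Real.exp_nonneg _)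

/-- `g_t` is even. [folklore] -/
theorem gaussLine_neg (t a : ℝ) : gaussLine t (-a) = gaussLine t a := by
  simp [gaussLine]

/-- `g_t(0) = (4πt)^{−1∕2}`. [folklore] -/
theorem gaussLine_zero (t : ℝ) : gaussLine t 0 = (Real.sqrt (4 * Real.pi * t))⁻¹ := by
  simp [gaussLine]

/-- ★ `g_t` is DECREASING in `|a|` (`t > 0`): `|a| ≤ |b| ⇒ g_t(b) ≤ g_t(a)`. [folklore] -/
theorem gaussLine_anti {t : ℝ} (ht : 0 < t) {a b : ℝ} (h : |a| ≤ |b|) : gaussLine t b ≤ gaussLine t a := by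
  unfold gaussLine
  refine mul_le_mul_of_nonneg_left (Real.exp_le_exp.mpr ?_) (inv_nonneg.mpr (Real.sqrt_nonneg _))
  have hab : a ^ 2 ≤ b ^ 2 := by
    rw [← sq_abs a, ← sq_abs b]
    exact pow_le_pow_left₀ (abs_nonneg a) h 2
  have h4 : 0 < 4 * t := by positivity
  exact neg_le_neg (div_le_div_of_nonneg_right hab h4.le)

/-- `g_t(a) ≤ g_t(0)` (the peak). [folklore] -/
theorem gaussLine_le_zero_val {t : ℝ} (ht : 0 < t) (a : ℝ) : gaussLine t a ≤ gaussLine t 0 :=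
  gaussLine_anti ht (by simp [abs_nonneg])

/-- `g_t` is continuous. [folklore] -/
theorem continuous_gaussLine (t : ℝ) : Continuous (gaussLine t) := by
  unfold gaussLine
  fun_prop

/-- `g_t` in Mathlib's Gaussian spelling: `g_t(a) = (4πt)^{−1∕2}·exp(−(4t)⁻¹·a²)`. [folklore] -/
theorem gaussLine_eq (t a : ℝ) : gaussLine t a = (Real.sqrt (4 * Real.pi * t))⁻¹ * Real.exp (-(4 * t)⁻¹ * a ^ 2) := by
  unfold gaussLine
  congr 2
  rw [neg_mul, div_eq_inv_mul]

/-- `g_t` is integrable (`t > 0`). [folklore] -/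
theorem integrable_gaussLine {t : ℝ} (ht : 0 < t) : Integrable (gaussLine t) := by
  have h : Integrable fun a : ℝ => (Real.sqrt (4 * Real.pi * t))⁻¹ * Real.exp (-(4 * t)⁻¹ * a ^ 2) :=
    (integrable_exp_neg_mul_sq (by positivity : (0 : ℝ) < (4 * t)⁻¹)).const_mul _
  exact h.congr (Eventually.of_forall fun a => (gaussLine_eq t a).symm)

/-- ★ `∫_ℝ g_t = 1` (`t > 0`). [folklore] -/
theorem integral_gaussLine {t : ℝ} (ht : 0 < t) : ∫ a : ℝ, gaussLine t a = 1 := by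
  have h4 : (0 : ℝ) < 4 * t := by positivity
  have hpt : (fun a : ℝ => gaussLine t a) = fun a => (Real.sqrt (4 * Real.pi * t))⁻¹ * Real.exp (-(4 * t)⁻¹ * a ^ 2) := funext (gaussLine_eq t)
  have hs : Real.pi / (4 * t)⁻¹ = 4 * Real.pi * t := by
    field_simp
  have hval : ∫ a : ℝ, Real.exp (-(4 * t)⁻¹ * a ^ 2) = Real.sqrt (4 * Real.pi * t) := by
    rw [integral_gaussian, hs]
  have hne : Real.sqrt (4 * Real.pi * t) ≠ 0 := (Real.sqrt_pos.mpr (by positivity)).ne'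
  rw [hpt, integral_const_mul, hval, inv_mul_cancel₀ hne]

/-- ★ **The Gaussian as the cosine transform of the heat kernel**: `∫_ℝ g_t(s)cos(qs)ds = e^{−tq²}` (`t > 0`; the tree's `integral_cos_mul_gaussian` BY NAME). [folklore] -/
theorem integral_gaussLine_mul_cos {t : ℝ} (ht : 0 < t) (q : ℝ) : ∫ s : ℝ, gaussLine t s * Real.cos (q * s) = Real.exp (-(t * q ^ 2)) := by
  have hα : (0 : ℝ) < (4 * t)⁻¹ := by positivity
  have key := Literature.MathematicalPhysics.QuantumLattice.integral_cos_mul_gaussian hα q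
  have hpt : (fun s : ℝ => gaussLine t s * Real.cos (q * s)) = fun s => (Real.sqrt (4 * Real.pi * t))⁻¹ * (Real.cos (q * s) * Real.exp (-(4 * t)⁻¹ * s ^ 2)) := by
    funext s
    rw [gaussLine_eq]
    ring
  rw [hpt, integral_const_mul, key]
  have hs : Real.pi / (4 * t)⁻¹ = 4 * Real.pi * t := by
    field_simp
  have he : -q ^ 2 / (4 * (4 * t)⁻¹) = -(t * q ^ 2) := by
    field_simp
  rw [hs, he, ← mul_assoc, inv_mul_cancel₀ (Real.sqrt_pos.mpr (by positivity)).ne', one_mul]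

/-! ## §3 The one-line proper-time integral `I_t(x) = ∫ sinc²(q∕2)e^{−tq²}cos(qx)dq = 2π(Λ ∗ g_t)(x)` -/

/-- **King's one-line proper-time integral** `I_t(x) := ∫_ℝ sinc²(q∕2)·e^{−tq²}·cos(qx)dq` — the `μ`-th factor of the momentum integral of `S₂^{ℝ}` at proper time `t`
(part Ϻ-b). [cite: King1986, (4.5) p.670, (4.36) p.674] -/
def lineHeat (t x : ℝ) : ℝ := ∫ q : ℝ, Real.sinc (q / 2) ^ 2 * Real.exp (-(t * q ^ 2)) * Real.cos (q * x)

/-- `∫_ℝ Λ = 1` for the tree's tent `Λ = tent 1` (its `integral_tent` on `[−1,1]`; `Λ` vanishes outside). [folklore] -/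
theorem integral_tent_one : ∫ u : ℝ, tent 1 u = 1 := by
  have hsupp : support (tent 1) ⊆ Ioc (-1 : ℝ) 1 := by
    intro u hu
    have h := abs_lt_of_tent_ne_zero one_pos hu
    rw [abs_lt] at h
    exact ⟨h.1, h.2.le⟩
  rw [← intervalIntegral.integral_eq_integral_of_support_subset hsupp]
  exact integral_tent one_pos

/-- `u ↦ Λ(u)·g_t(x−u)` is integrable (`|Λ| ≤ 1`, `g_t(x−·)` integrable). [folklore] -/
theorem integrable_tent_mul_gaussLine {t : ℝ} (ht : 0 < t) (x : ℝ) : Integrable fun u : ℝ => tent 1 u * gaussLine t (x - u) := by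
  have hg : Integrable fun u : ℝ => gaussLine t (x - u) := (integrable_gaussLine ht).comp_sub_left x
  refine hg.mono' ((continuous_tent 1).aestronglyMeasurable.mul hg.aestronglyMeasurable) (Eventually.of_forall fun u => ?_)
  rw [Real.norm_eq_abs, abs_mul, abs_of_nonneg (tent_nonneg _ _), abs_of_nonneg (gaussLine_nonneg _ _)]
  exact mul_le_of_le_one_left (gaussLine_nonneg _ _) (tent_le_one one_pos _)

/-- `Λ` is integrable on `ℝ`. [folklore] -/
theorem integrable_tent_one : Integrable (tent 1 : ℝ → ℝ) := by
  refine (continuous_tent 1).integrable_of_hasCompactSupport (HasCompactSupport.intro isCompact_Icc (K := Icc (-1 : ℝ) 1) fun u hu => ?_)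
  apply tent_eq_zero one_pos
  rw [mem_Icc, not_and_or, not_le, not_le] at hu
  rcases hu with h | h
  · rw [abs_of_neg (by linarith)]; linarith
  · rw [abs_of_pos (by linarith)]; linarith

/-- ★★★ **THE ONE-LINE PROPER-TIME INTEGRAL IS THE TENT-SMEARED HEAT KERNEL**: for `t > 0` and every `x`,
`I_t(x) = ∫ sinc²(q∕2)e^{−tq²}cos(qx)dq = 2π·∫_ℝ Λ(u)·g_t(x − u)du`, `Λ = (1−|u|)₊`, `g_t(a) = (4πt)^{−1∕2}e^{−a²∕4t}`.
PROOF: `e^{−tq²} = ∫g_t(s)cos(qs)ds`; Fubini (majorant `sinc²(q∕2)·g_t(s)`); `cos(qx)cos(qs) = ½[cos(q(x+s)) + cos(q(x−s))]`; the Fejér pair `∫sinc²(q∕2)cos(qv)dq = 2πΛ(v)`;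
the two halves agree under `s ↦ −s`; finally `u = x − s`. [cite: King1986, (4.5) p.670, Thm 3.3 (3.6) p.655; ButzerNessel1971, (12.4.3)] -/
theorem lineHeat_eq_integral_tent {t : ℝ} (ht : 0 < t) (x : ℝ) : lineHeat t x = 2 * Real.pi * ∫ u : ℝ, tent 1 u * gaussLine t (x - u) := by
  -- Step 1: insert the cosine transform of the heat kernel
  have hstep1 : lineHeat t x = ∫ q : ℝ, ∫ s : ℝ, Real.sinc (q / 2) ^ 2 * Real.cos (q * x) * (gaussLine t s * Real.cos (q * s)) := by
    unfold lineHeat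
    refine integral_congr_ae (Eventually.of_forall fun q => ?_)
    simp only
    rw [integral_const_mul, integral_gaussLine_mul_cos ht q]
    ring
  -- Step 2: Fubini
  set F : ℝ → ℝ → ℝ := fun q s => Real.sinc (q / 2) ^ 2 * Real.cos (q * x) * (gaussLine t s * Real.cos (q * s)) with hF
  have hA : Integrable fun q : ℝ => Real.sinc (q / 2) ^ 2 := by
    have h := integrable_sinc_sq_half_mul_cos 0
    simp only [mul_zero, Real.cos_zero, mul_one] at h
    exact h
  have hmaj : Integrable (fun p : ℝ × ℝ => Real.sinc (p.1 / 2) ^ 2 * gaussLine t p.2) (volume.prod volume) := hA.mul_prod (integrable_gaussLine ht)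
  have hcont : Continuous (uncurry F) := by
    simp only [hF]
    have hc : Continuous fun p : ℝ × ℝ => gaussLine t p.2 := (continuous_gaussLine t).comp continuous_snd
    fun_prop
  have hint : Integrable (uncurry F) (volume.prod volume) := by
    refine hmaj.mono' hcont.aestronglyMeasurable (Eventually.of_forall fun p => ?_)
    simp only [hF, uncurry, Real.norm_eq_abs]
    rw [abs_mul, abs_mul, abs_mul, abs_of_nonneg (sq_nonneg (Real.sinc (p.1 / 2))), abs_of_nonneg (gaussLine_nonneg t p.2)]
    have h1 := Real.abs_cos_le_one (p.1 * x)
    have h2 := Real.abs_cos_le_one (p.1 * p.2)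
    have hsg : 0 ≤ Real.sinc (p.1 / 2) ^ 2 * gaussLine t p.2 := mul_nonneg (sq_nonneg _) (gaussLine_nonneg t p.2)
    calc Real.sinc (p.1 / 2) ^ 2 * |Real.cos (p.1 * x)| * (gaussLine t p.2 * |Real.cos (p.1 * p.2)|)
        = (Real.sinc (p.1 / 2) ^ 2 * gaussLine t p.2) * (|Real.cos (p.1 * x)| * |Real.cos (p.1 * p.2)|) := by ring
      _ ≤ (Real.sinc (p.1 / 2) ^ 2 * gaussLine t p.2) * 1 :=
          mul_le_mul_of_nonneg_left (mul_le_one₀ h1 (abs_nonneg _) h2) hsg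
      _ = Real.sinc (p.1 / 2) ^ 2 * gaussLine t p.2 := mul_one _
  have hswap := integral_integral_swap hint
  simp only [hF] at hswap
  rw [hstep1, hswap]
  -- Step 3: the inner `q`-integral is `π(Λ(x+s) + Λ(x−s))`
  have hinner : ∀ s : ℝ, ∫ q : ℝ, Real.sinc (q / 2) ^ 2 * Real.cos (q * x) * (gaussLine t s * Real.cos (q * s))
      = gaussLine t s * (Real.pi * (tent 1 (x + s) + tent 1 (x - s))) := by
    intro s
    have hpt : (fun q : ℝ => Real.sinc (q / 2) ^ 2 * Real.cos (q * x) * (gaussLine t s * Real.cos (q * s)))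
        = fun q => gaussLine t s * ((1 / 2) * (Real.sinc (q / 2) ^ 2 * Real.cos (q * (x + s))) + (1 / 2) * (Real.sinc (q / 2) ^ 2 * Real.cos (q * (x - s)))) := by
      funext q
      rw [mul_add q x s, mul_sub q x s, Real.cos_add, Real.cos_sub]
      ring
    rw [hpt, integral_const_mul, integral_add ((integrable_sinc_sq_half_mul_cos _).const_mul _) ((integrable_sinc_sq_half_mul_cos _).const_mul _),
      integral_const_mul, integral_const_mul, integral_sinc_sq_half_mul_cos_eq_tent, integral_sinc_sq_half_mul_cos_eq_tent]
    ring
  simp_rw [hinner]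
  -- Step 4: symmetrise and substitute
  have hsym : ∫ s : ℝ, gaussLine t s * tent 1 (x + s) = ∫ s : ℝ, gaussLine t s * tent 1 (x - s) := by
    have h := integral_neg_eq_self (fun s : ℝ => gaussLine t s * tent 1 (x - s)) volume
    simp only [gaussLine_neg, sub_neg_eq_add] at h
    exact h
  have hI1 : Integrable fun s : ℝ => gaussLine t s * tent 1 (x - s) := by
    have h := (integrable_tent_mul_gaussLine ht x).comp_sub_left x
    refine h.congr (Eventually.of_forall fun s => ?_)
    simp only [sub_sub_cancel]
    ring
  have hI2 : Integrable fun s : ℝ => gaussLine t s * tent 1 (x + s) := by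
    have h := hI1.comp_neg
    refine h.congr (Eventually.of_forall fun s => ?_)
    simp only [gaussLine_neg, sub_neg_eq_add]
  have hsplit : (fun s : ℝ => gaussLine t s * (Real.pi * (tent 1 (x + s) + tent 1 (x - s))))
      = fun s => Real.pi * (gaussLine t s * tent 1 (x + s)) + Real.pi * (gaussLine t s * tent 1 (x - s)) := by
    funext s; ring
  rw [hsplit, integral_add (hI2.const_mul _) (hI1.const_mul _), integral_const_mul, integral_const_mul, hsym]
  have hsub : ∫ s : ℝ, gaussLine t s * tent 1 (x - s) = ∫ u : ℝ, tent 1 u * gaussLine t (x - u) := by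
    have h := integral_sub_left_eq_self (fun u : ℝ => tent 1 u * gaussLine t (x - u)) volume x
    simp only [sub_sub_cancel] at h
    rw [← h]
    refine integral_congr_ae (Eventually.of_forall fun s => ?_)
    simp only
    ring
  rw [hsub]
  ring

/-- ★ **Upper envelope on the tent**: if `1 ≤ |x|` then `Λ(u)g_t(x−u) ≤ Λ(u)g_t(|x|−1)` for all `u` (on the support `|u| < 1`, `|x−u| ≥ |x|−1 ≥ 0`). [folklore] -/
theorem tent_mul_gaussLine_le {t : ℝ} (ht : 0 < t) {x : ℝ} (hx : 1 ≤ |x|) (u : ℝ) :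
    tent 1 u * gaussLine t (x - u) ≤ tent 1 u * gaussLine t (|x| - 1) := by
  by_cases hu : tent 1 u = 0
  · rw [hu, zero_mul, zero_mul]
  · have hu1 := abs_lt_of_tent_ne_zero one_pos hu
    refine mul_le_mul_of_nonneg_left (gaussLine_anti ht ?_) (tent_nonneg _ _)
    rw [abs_of_nonneg (by linarith)]
    have := abs_sub_abs_le_abs_sub x u
    linarith

/-- ★ **Lower envelope on the tent**: `Λ(u)g_t(|x|+1) ≤ Λ(u)g_t(x−u)` for all `u` (on the support, `|x−u| ≤ |x|+1`). [folklore] -/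
theorem tent_mul_gaussLine_ge {t : ℝ} (ht : 0 < t) (x u : ℝ) :
    tent 1 u * gaussLine t (|x| + 1) ≤ tent 1 u * gaussLine t (x - u) := by
  by_cases hu : tent 1 u = 0
  · rw [hu, zero_mul, zero_mul]
  · have hu1 := abs_lt_of_tent_ne_zero one_pos hu
    refine mul_le_mul_of_nonneg_left (gaussLine_anti ht ?_) (tent_nonneg _ _)
    rw [abs_of_nonneg (by positivity : (0 : ℝ) ≤ |x| + 1)]
    have := abs_sub x u
    linarith

/-- ★ **LOWER ENVELOPE**: `2π·g_t(|x|+1) ≤ I_t(x)` (`t > 0`, every `x`). [folklore] -/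
theorem envelope_le_lineHeat {t : ℝ} (ht : 0 < t) (x : ℝ) : 2 * Real.pi * gaussLine t (|x| + 1) ≤ lineHeat t x := by
  rw [lineHeat_eq_integral_tent ht x]
  refine mul_le_mul_of_nonneg_left ?_ (by positivity)
  have h := integral_mono ((integrable_tent_one).mul_const (gaussLine t (|x| + 1))) (integrable_tent_mul_gaussLine ht x) (tent_mul_gaussLine_ge ht x)
  rwa [integral_mul_const, integral_tent_one, one_mul] at h

/-- ★★ **POSITIVITY**: `I_t(x) > 0` for every `t > 0` and EVERY `x ∈ ℝ`. [folklore] -/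
theorem lineHeat_pos {t : ℝ} (ht : 0 < t) (x : ℝ) : 0 < lineHeat t x :=
  lt_of_lt_of_le (by have := gaussLine_pos ht (|x| + 1); positivity) (envelope_le_lineHeat ht x)

/-- `I_t(x) ≥ 0`. [folklore] -/
theorem lineHeat_nonneg {t : ℝ} (ht : 0 < t) (x : ℝ) : 0 ≤ lineHeat t x := (lineHeat_pos ht x).le

/-- ★ **UPPER ENVELOPE**: for `|x| ≥ 1`, `I_t(x) ≤ 2π·g_t(|x| − 1)`. [folklore] -/
theorem lineHeat_le_envelope {t : ℝ} (ht : 0 < t) {x : ℝ} (hx : 1 ≤ |x|) : lineHeat t x ≤ 2 * Real.pi * gaussLine t (|x| - 1) := by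
  rw [lineHeat_eq_integral_tent ht x]
  refine mul_le_mul_of_nonneg_left ?_ (by positivity)
  have h := integral_mono (integrable_tent_mul_gaussLine ht x) ((integrable_tent_one).mul_const (gaussLine t (|x| - 1))) (tent_mul_gaussLine_le ht hx)
  rwa [integral_mul_const, integral_tent_one, one_mul] at h

/-- **PEAK BOUND**: `I_t(x) ≤ 2π·g_t(0) = 2π(4πt)^{−1∕2}` for every `x`. [folklore] -/
theorem lineHeat_le_peak {t : ℝ} (ht : 0 < t) (x : ℝ) : lineHeat t x ≤ 2 * Real.pi * gaussLine t 0 := by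
  rw [lineHeat_eq_integral_tent ht x]
  refine mul_le_mul_of_nonneg_left ?_ (by positivity)
  have hpt : ∀ u : ℝ, tent 1 u * gaussLine t (x - u) ≤ tent 1 u * gaussLine t 0 := fun u =>
    mul_le_mul_of_nonneg_left (gaussLine_le_zero_val ht _) (tent_nonneg _ _)
  have h := integral_mono (integrable_tent_mul_gaussLine ht x) ((integrable_tent_one).mul_const (gaussLine t 0)) hpt
  rwa [integral_mul_const, integral_tent_one, one_mul] at h

/-- ★ **CAP**: `I_t(x) ≤ 2π` (`Λ ≤ 1` and `∫g_t = 1`; equivalently `∫sinc²(q∕2)e^{−tq²}|cos| ≤ ∫sinc²(q∕2) = 2π`). [folklore] -/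
theorem lineHeat_le_two_pi {t : ℝ} (ht : 0 < t) (x : ℝ) : lineHeat t x ≤ 2 * Real.pi := by
  rw [lineHeat_eq_integral_tent ht x]
  have hg : Integrable fun u : ℝ => gaussLine t (x - u) := (integrable_gaussLine ht).comp_sub_left x
  have hpt : ∀ u : ℝ, tent 1 u * gaussLine t (x - u) ≤ gaussLine t (x - u) := fun u =>
    mul_le_of_le_one_left (gaussLine_nonneg _ _) (tent_le_one one_pos _)
  have h := integral_mono (integrable_tent_mul_gaussLine ht x) hg hpt
  have h1 : ∫ u : ℝ, gaussLine t (x - u) = 1 := by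
    rw [integral_sub_left_eq_self (gaussLine t) volume x, integral_gaussLine ht]
  rw [h1] at h
  calc 2 * Real.pi * ∫ u : ℝ, tent 1 u * gaussLine t (x - u) ≤ 2 * Real.pi * 1 := mul_le_mul_of_nonneg_left h (by positivity)
    _ = 2 * Real.pi := mul_one _

/-- `I_t` is even in `x`. [folklore] -/
theorem lineHeat_neg (t x : ℝ) : lineHeat t (-x) = lineHeat t x := by
  unfold lineHeat
  simp [mul_neg, Real.cos_neg]

end Summit.QuantumFields.YangMills.BalabanUVNodes.N15KingModelRung.ProperTime
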